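import Mathlib
import Summits.ValiantsHypothesis.ValiantsHypothesis.Theorems.DivisionGapPerMultiplesHardStubTorus
import Literature.Computability.AlgebraicComplexity.ArithCircuitProofs
import Literature.Computability.AlgebraicComplexity.PermanentIrreducible

/-!
# `DivisionGap.PerMultiplesHard` (stmt-ValiantsHypothesis-5068), line `uncharged-face-walk`:
the torus/content normal form AT A HOST (stub `stub_hostTorus`)

For a face `G ⊆ [n]²` let `per_G := ∑_{σ ⊆ G} x^{μ_σ}` be the face permanent (the sum of the
permutation monomials of the permutations whose graph lies inside `G`).  For every nonzero
`q ∈ ℝ≥0[x_ij]` (`n × n` variables) there are an exponent `g` and a nonzero `q'` with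

* `q'` **torus-homogeneous**: all monomials of `q'` have the same row margins `r` and the same
  column margins `cc`;
* `q'` **content-free**: every cell `e` is missed by some monomial of `q'`;
* `x^g · q'` is a **sub-sum** of `q`: every `g + m'`, `m' ∈ supp q'`, is an exponent of `q`;
* `L⁺(per_G · x^g · q') ≤ L⁺(per_G · q)` for the tree's monotone fan-in-two `complexity` over
  `ℝ≥0`.

Mechanism (the landed `Torus.stub_torus` with `per_n` replaced by `per_G`).  Every permutation
monomial `x^{μ_σ}` takes exactly one variable from each row and each column, so `per_G` is
homogeneous of weight `1` for each of the `2n` row/column indicator weights; over `ℝ≥0` top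
components are free and multiplicative, so iterating `q ↦ top_w q` over these weights
(`List.foldr topComponent`) gives a torus-homogeneous sub-sum `q₁ ≠ 0` of `q` with
`L⁺(per_G · q₁) ≤ L⁺(per_G · q)` (`Torus.complexity_mul_foldr_topComponent_le`); then
`Torus.exists_divide_content` factors `q₁ = x^g · q'` exactly with `q'` content-free.

Log (stub-worker): written on the `Torus` / `TopComponentFree` API. [folklore]
-/

noncomputable section

open MvPolynomial Literature.Computability.AlgebraicComplexity
open scoped NNReal BigOperators
open Summit.ValiantsHypothesis.ValiantsHypothesis.Theorems.ZeroOneTransfer.Negative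

namespace Summit.ValiantsHypothesis.ValiantsHypothesis.Theorems.DivisionGap.PerMultiplesHard.HostTorus

variable {n : ℕ}

/-! ### Iterated top components are sub-sums -/

/-- Iterated top components are sub-sums: the support only shrinks along the fold. [folklore] -/
theorem support_foldr_topComponent_subset {τ : Type*} (ws : List (τ → ℕ))
    (p : MvPolynomial τ ℝ≥0) : (ws.foldr topComponent p).support ⊆ p.support := by
  induction ws with
  | nil => exact subset_rfl
  | cons w ws ih =>
    rw [List.foldr_cons]
    exact (support_topComponent_subset w _).trans ih

/-! ### The face permanent is homogeneous for the row and column indicator weights -/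

/-- The face permanent takes exactly one variable from each row: it is homogeneous of degree `1`
for every row indicator weight. [folklore] -/
theorem isWeightedHomogeneous_facePer_row (G : Finset (Fin n × Fin n)) (i : Fin n) :
    IsWeightedHomogeneous (fun v : Fin n × Fin n => if v.1 = i then 1 else 0)
      (∑ σ ∈ (Finset.univ : Finset (Equiv.Perm (Fin n))).filter (fun σ => ∀ i, (σ i, i) ∈ G),
        monomial (permMonomial σ) (1 : ℝ≥0)) 1 := by
  refine IsWeightedHomogeneous.sum _ _ 1 fun ρ _ => isWeightedHomogeneous_monomial _ _ _ ?_
  rw [Torus.weight_rowIndicator]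
  exact rowCount_permMonomial ρ i

/-- The face permanent takes exactly one variable from each column: it is homogeneous of degree
`1` for every column indicator weight. [folklore] -/
theorem isWeightedHomogeneous_facePer_col (G : Finset (Fin n × Fin n)) (j : Fin n) :
    IsWeightedHomogeneous (fun v : Fin n × Fin n => if v.2 = j then 1 else 0)
      (∑ σ ∈ (Finset.univ : Finset (Equiv.Perm (Fin n))).filter (fun σ => ∀ i, (σ i, i) ∈ G),
        monomial (permMonomial σ) (1 : ℝ≥0)) 1 := by
  refine IsWeightedHomogeneous.sum _ _ 1 fun ρ _ => isWeightedHomogeneous_monomial _ _ _ ?_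
  rw [Torus.weight_colIndicator]
  exact colCount_permMonomial ρ j

/-! ### Step 1: torus-homogeneous sub-sums at no cost -/

-- adapted from `Torus.exists_torus_multiple_le` (per_n ↦ per_G, plus the sub-sum clause)
/-- **WLOG the multiplier is torus-homogeneous, for free, at a host.** For every nonzero `q`
there is a nonzero sub-sum `q₁` of `q` all of whose monomials have the same row margins and the
same column margins, with `L⁺(per_G · q₁) ≤ L⁺(per_G · q)`: iterate top components over the `2n`
row/column indicator weights, for each of which `per_G` is homogeneous. [folklore] -/
theorem exists_torus_subsum_le (G : Finset (Fin n × Fin n))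
    (q : MvPolynomial (Fin n × Fin n) ℝ≥0) (hq : q ≠ 0) :
    ∃ q₁ : MvPolynomial (Fin n × Fin n) ℝ≥0, q₁ ≠ 0 ∧
      (∀ i, ∀ d₁ ∈ q₁.support, ∀ d₂ ∈ q₁.support, ∑ j, d₁ (i, j) = ∑ j, d₂ (i, j)) ∧
      (∀ j, ∀ d₁ ∈ q₁.support, ∀ d₂ ∈ q₁.support, ∑ i, d₁ (i, j) = ∑ i, d₂ (i, j)) ∧
      q₁.support ⊆ q.support ∧
      complexity ((∑ σ ∈ (Finset.univ : Finset (Equiv.Perm (Fin n))).filter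
            (fun σ => ∀ i, (σ i, i) ∈ G), monomial (permMonomial σ) (1 : ℝ≥0)) * q₁) ≤
        complexity ((∑ σ ∈ (Finset.univ : Finset (Equiv.Perm (Fin n))).filter
            (fun σ => ∀ i, (σ i, i) ∈ G), monomial (permMonomial σ) (1 : ℝ≥0)) * q) := by
  classical
  let ws : List (Fin n × Fin n → ℕ) :=
    (List.finRange n).map (fun i v => if v.1 = i then 1 else 0) ++
      (List.finRange n).map (fun j v => if v.2 = j then 1 else 0)
  have hrow_mem : ∀ i : Fin n, (fun v : Fin n × Fin n => if v.1 = i then 1 else 0) ∈ ws :=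
    fun i => List.mem_append_left _ (List.mem_map.2 ⟨i, List.mem_finRange i, rfl⟩)
  have hcol_mem : ∀ j : Fin n, (fun v : Fin n × Fin n => if v.2 = j then 1 else 0) ∈ ws :=
    fun j => List.mem_append_right _ (List.mem_map.2 ⟨j, List.mem_finRange j, rfl⟩)
  refine ⟨ws.foldr topComponent q, Torus.foldr_topComponent_ne_zero ws hq, ?_, ?_,
    support_foldr_topComponent_subset ws q, ?_⟩
  · intro i d₁ hd₁ d₂ hd₂
    obtain ⟨m, hm⟩ := Torus.isWeightedHomogeneous_foldr_topComponent ws q (hrow_mem i)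
    rw [← Torus.weight_rowIndicator i d₁, ← Torus.weight_rowIndicator i d₂,
      hm (mem_support_iff.1 hd₁), hm (mem_support_iff.1 hd₂)]
  · intro j d₁ hd₁ d₂ hd₂
    obtain ⟨m, hm⟩ := Torus.isWeightedHomogeneous_foldr_topComponent ws q (hcol_mem j)
    rw [← Torus.weight_colIndicator j d₁, ← Torus.weight_colIndicator j d₂,
      hm (mem_support_iff.1 hd₁), hm (mem_support_iff.1 hd₂)]
  · refine Torus.complexity_mul_foldr_topComponent_le ws _ q fun w hw => ?_
    rcases List.mem_append.1 hw with hw' | hw'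
    · obtain ⟨i, -, rfl⟩ := List.mem_map.1 hw'
      exact ⟨1, isWeightedHomogeneous_facePer_row G i⟩
    · obtain ⟨j, -, rfl⟩ := List.mem_map.1 hw'
      exact ⟨1, isWeightedHomogeneous_facePer_col G j⟩

/-! ### The stub -/

/-- **Torus/content normal form at a host** (stub `stub_hostTorus` of line
`uncharged-face-walk`): for every face `G` and every nonzero `q` there are an exponent `g` and a
nonzero torus-homogeneous, content-free `q'` such that `x^g · q'` is a sub-sum of `q` and
`L⁺(per_G · x^g · q') ≤ L⁺(per_G · q)` — free iterated top components over the `2n` row/column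
weights (`per_G` is homogeneous of weight `1` for each), then division by the pointwise-minimum
monomial (`Torus.exists_divide_content`). [folklore] -/
theorem stub_hostTorus :
    ∀ (n : ℕ) (G : Finset (Fin n × Fin n)) (q : MvPolynomial (Fin n × Fin n) ℝ≥0), q ≠ 0 →
      ∃ (g : (Fin n × Fin n) →₀ ℕ) (q' : MvPolynomial (Fin n × Fin n) ℝ≥0), q' ≠ 0 ∧
        (∃ r cc : Fin n → ℕ, ∀ m ∈ q'.support, (∀ i, ∑ j, m (i, j) = r i) ∧ (∀ j, ∑ i, m (i, j) = cc j)) ∧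
        (∀ e : Fin n × Fin n, ∃ m ∈ q'.support, m e = 0) ∧
        (∀ m' ∈ q'.support, g + m' ∈ q.support) ∧
        complexity ((∑ σ ∈ (Finset.univ : Finset (Equiv.Perm (Fin n))).filter (fun σ => ∀ i, (σ i, i) ∈ G),
              monomial (permMonomial σ) (1 : ℝ≥0)) * (monomial g (1 : ℝ≥0) * q')) ≤
          complexity ((∑ σ ∈ (Finset.univ : Finset (Equiv.Perm (Fin n))).filter (fun σ => ∀ i, (σ i, i) ∈ G),
              monomial (permMonomial σ) (1 : ℝ≥0)) * q) := by
  intro n G q hq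
  obtain ⟨q₁, q₁0, hrow, hcol, hsub, hL⟩ := exists_torus_subsum_le G q hq
  obtain ⟨g, q', q'0, htor, hcf, hfac⟩ := Torus.exists_divide_content q₁ q₁0 hrow hcol
  refine ⟨g, q', q'0, htor, hcf, fun m' hm' => hsub ?_, by rw [hfac]; exact hL⟩
  -- `coeff (g + m') (x^g · q') = coeff m' q' ≠ 0`
  rw [mem_support_iff, ← hfac, coeff_monomial_mul, one_mul]
  exact mem_support_iff.1 hm'

end Summit.ValiantsHypothesis.ValiantsHypothesis.Theorems.DivisionGap.PerMultiplesHard.HostTorus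

end
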